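import Summits.Ventures.PercRepro.C026PassM

/-!
# The H-graph dictionary for C-026 (mine-3's Theorem B) (p5, gen 7)

mine-3's `proofs/MINE3-Q3-proof.md` §2 reads the three events of the D-free inequality in the
**H-graph** `H_S` of a configuration `S` with `M = Com_c(S)`: inside `M` the `S`-closed edges, between `M`
and the rest every edge of `G`, and free movement inside every other `S`-cluster.  At the vertex level:

* **`HAdj S c u v`** — an H-step: a closed edge inside `M`, an edge between `M` and `V ∖ M`, or
  `S`-connectivity outside `M`; **`HConnAvoid S c X`** — H-walks avoiding the vertex set `X`;
* the general flip lemma **`conn_flipM_iff`**: for a union of `S`-clusters `X` disjoint from `M`, the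
  configuration `S Δ (E[M] ∖ E[X])` connects `u ∉ X` to `v` iff some H-walk avoiding `X` does;
* **Theorem B (a)** `conn_kSwap_iff_hConn` — `u ~ v` in `δ(S) = S Δ E[M]` iff `u ~_H v`
  (`X = ∅`; for `S ∈ bot`: `S ∈ BAD ⟺ K ~_H L`);
* **Theorem B (b), (c)** `conn_kSwapSealed_iff_hConnAvoid` — `u ~ v` in `τ₅₀(S) = S Δ (E[M] ∖ E[L])` iff
  some H-walk from `u` to `v` avoids `L` (`X = L = Com_b(S)`, `b ≁ c`); so `τ₅₀(S) ∈ ac|b ⟺ c ~_H K` in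
  `H − L` and `τ₁₈(S) ∈ bc|a ⟺ c ~_H L` in `H − K` (`cellAC_kSwapSealed_iff`, `cellBC_kSwapSealed_iff`);
* **`dFreeIneq_iff_hGraph`** — mine-3's D-free inequality in its H-graph form
  `#{bot : a ~_H b} ≤ #{bot : c ~_H a avoiding L} + #{bot : c ~_H b avoiding K}` is `DFreeIneq`.
-/

namespace PercRepro

namespace MultiGraph

section HGraph

variable {V E : Type*} (G : MultiGraph V E)

/-- An edge of `G` joins `u` and `v` (in either order). -/
def Joins (e : E) (u v : V) : Prop := (G.fst e = u ∧ G.snd e = v) ∨ (G.fst e = v ∧ G.snd e = u)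

/-- **An H-step of mine-3's H-graph** (`M = Com_c(S)`): a closed edge inside `M`; an edge between `M` and
`V ∖ M`; or `S`-connectivity outside `M` (free movement inside the other clusters). -/
def HAdj (S : Config E) (c u v : V) : Prop :=
  (u ∈ G.cluster S c ∧ v ∈ G.cluster S c ∧ ∃ e, S e = false ∧ G.Joins e u v) ∨
    ((u ∈ G.cluster S c ↔ v ∉ G.cluster S c) ∧ ∃ e, G.Joins e u v) ∨
      (u ∉ G.cluster S c ∧ v ∉ G.cluster S c ∧ G.Conn S u v)

/-- H-walks avoiding the vertex set `X` (the H-graph with the clusters inside `X` deleted). -/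
def HConnAvoid (S : Config E) (c : V) (X : Set V) (u v : V) : Prop :=
  Relation.ReflTransGen (fun x y => G.HAdj S c x y ∧ x ∉ X ∧ y ∉ X) u v

/-- H-connectivity (no deletion). -/
def HConn (S : Config E) (c u v : V) : Prop := Relation.ReflTransGen (G.HAdj S c) u v

open Classical in
/-- The flip of the edges at `M = Com_c(S)` that are not at `X`. -/
noncomputable def flipM (S : Config E) (c : V) (X : Set V) : Config E :=
  fun e => if e ∈ G.edgesAt (G.cluster S c) ∧ e ∉ G.edgesAt X then !S e else S e

/-- `δ(S) = S Δ E[M]` is the flip with nothing sealed. -/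
theorem kSwap_eq_flipM (S : Config E) (c : V) : G.kSwap c S = G.flipM S c ∅ := by
  funext e
  by_cases h : e ∈ G.edgesAt (G.cluster S c)
  · have h' : e ∉ G.edgesAt (∅ : Set V) := by simp [edgesAt]
    simp [kSwap, flipM, h, h']
  · simp [kSwap, flipM, h]

/-- `τ(S) = S Δ (E[M] ∖ E[Com_x S])` is the flip with the cluster of `x` sealed. -/
theorem kSwapSealed_eq_flipM (S : Config E) (c x : V) :
    G.kSwapSealed c x S = G.flipM S c (G.cluster S x) := rfl

/-- The cluster of a vertex outside `M` is disjoint from `M`. -/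
theorem not_mem_cluster_c_of_mem_cluster {S : Config E} {c u w : V} (hu : u ∉ G.cluster S c)
    (hw : w ∈ G.cluster S u) : w ∉ G.cluster S c :=
  fun hwc => hu ((hwc : G.Conn S c w).trans (hw : G.Conn S u w).symm)

/-- An edge joining `x ∈ X` to anything is at `X`. -/
theorem mem_edgesAt_of_joins_left {X : Set V} {e : E} {x y : V} (hj : G.Joins e x y) (hx : x ∈ X) :
    e ∈ G.edgesAt X := by
  rcases hj with ⟨h, _⟩ | ⟨_, h⟩
  · exact Or.inl (h ▸ hx)
  · exact Or.inr (h ▸ hx)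

/-- An edge joining anything to `y ∈ X` is at `X`. -/
theorem mem_edgesAt_of_joins_right {X : Set V} {e : E} {x y : V} (hj : G.Joins e x y) (hy : y ∈ X) :
    e ∈ G.edgesAt X := by
  rcases hj with ⟨_, h⟩ | ⟨h, _⟩
  · exact Or.inr (h ▸ hy)
  · exact Or.inl (h ▸ hy)

/-- An edge at `X` joining `x` and `y` has `x ∈ X` or `y ∈ X`. -/
theorem mem_or_mem_of_mem_edgesAt_of_joins {X : Set V} {e : E} {x y : V} (hj : G.Joins e x y)
    (he : e ∈ G.edgesAt X) : x ∈ X ∨ y ∈ X := by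
  rcases hj with ⟨h1, h2⟩ | ⟨h1, h2⟩ <;> rcases he with he | he
  · exact Or.inl (h1 ▸ he)
  · exact Or.inr (h2 ▸ he)
  · exact Or.inr (h1 ▸ he)
  · exact Or.inl (h2 ▸ he)

/-- An `S`-open edge joining `x` and `y` keeps the cluster of `c`: `x ∈ M → y ∈ M`. -/
theorem mem_cluster_of_open_joins {S : Config E} {c x y : V} {e : E} (he : S e = true)
    (hj : G.Joins e x y) (hx : x ∈ G.cluster S c) : y ∈ G.cluster S c :=
  (hx : G.Conn S c x).trans (Conn.of_openAdj ⟨e, he, hj⟩)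

/-- An `S`-open edge with an endpoint in `M` has both endpoints in `M`; so an open edge between `M` and
`V ∖ M` does not exist. -/
theorem eq_false_of_joins_of_mem_of_notMem {S : Config E} {c u v : V} {e : E}
    (hj : G.Joins e u v) (hu : u ∈ G.cluster S c) (hv : v ∉ G.cluster S c) : S e = false := by
  by_contra h
  have he : S e = true := by simpa using h
  exact hv (G.mem_cluster_of_open_joins he hj hu)

/-- **The general flip lemma**: with `X` a union of `S`-clusters (no `S`-open edge crosses its
boundary), `u ∉ X` and `v` are connected in the flip `S Δ (E[M] ∖ E[X])` iff some H-walk avoiding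
`X` joins them. -/
theorem conn_flipM_iff {S : Config E} {c : V} {X : Set V}
    (hXcl : ∀ e, S e = true → (G.fst e ∈ X ↔ G.snd e ∈ X)) {u : V} (hu : u ∉ X) (v : V) :
    G.Conn (G.flipM S c X) u v ↔ G.HConnAvoid S c X u v := by
  -- an `S`-open edge respects `X`
  have hXj : ∀ {e : E} {x y : V}, S e = true → G.Joins e x y → (x ∈ X ↔ y ∈ X) := by
    intro e x y he hj
    rcases hj with ⟨h1, h2⟩ | ⟨h1, h2⟩
    · rw [← h1, ← h2]
      exact hXcl e he
    · rw [← h1, ← h2]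
      exact (hXcl e he).symm
  constructor
  · intro h
    -- along the open path every vertex stays outside `X` and every step is an H-step
    suffices key : v ∉ X ∧ G.HConnAvoid S c X u v from key.2
    refine Conn.induction (motive := fun x => x ∉ X ∧ G.HConnAvoid S c X u x)
      ⟨hu, Relation.ReflTransGen.refl⟩ ?_ h
    intro x y _ hxy ⟨hx, hwalk⟩
    obtain ⟨e, he, hend⟩ := hxy
    have hj : G.Joins e x y := hend
    by_cases hflip : e ∈ G.edgesAt (G.cluster S c) ∧ e ∉ G.edgesAt X
    · -- a flipped edge: closed in `S`, at `M`, not at `X`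
      have hSe : S e = false := by
        have : G.flipM S c X e = !S e := by simp [flipM, hflip]
        rw [this] at he
        simpa using he
      have hy : y ∉ X := fun hyX => hflip.2 (G.mem_edgesAt_of_joins_right hj hyX)
      refine ⟨hy, hwalk.tail ⟨?_, hx, hy⟩⟩
      by_cases hxM : x ∈ G.cluster S c <;> by_cases hyM : y ∈ G.cluster S c
      · exact Or.inl ⟨hxM, hyM, e, hSe, hj⟩
      · exact Or.inr (Or.inl ⟨⟨fun _ => hyM, fun _ => hxM⟩, e, hj⟩)
      · exact Or.inr (Or.inl ⟨⟨fun h => absurd h hxM, fun h => absurd hyM h⟩, e, hj⟩)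
      · exfalso
        rcases G.mem_or_mem_of_mem_edgesAt_of_joins hj hflip.1 with h | h
        · exact hxM h
        · exact hyM h
    · -- an unflipped edge: open in `S`, hence inside an `S`-cluster away from `M`
      have hSe : S e = true := by
        have : G.flipM S c X e = S e := by simp [flipM, hflip]
        rwa [this] at he
      have hy : y ∉ X := fun hyX => hx ((hXj hSe hj).mpr hyX)
      have hnotX : e ∉ G.edgesAt X := by
        intro heX
        rcases G.mem_or_mem_of_mem_edgesAt_of_joins hj heX with h | h
        · exact hx h
        · exact hy h
      have hnotM : e ∉ G.edgesAt (G.cluster S c) := fun heM => hflip ⟨heM, hnotX⟩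
      have hxM : x ∉ G.cluster S c := fun hxM => hnotM (G.mem_edgesAt_of_joins_left hj hxM)
      have hyM : y ∉ G.cluster S c := fun hyM => hnotM (G.mem_edgesAt_of_joins_right hj hyM)
      exact ⟨hy, hwalk.tail ⟨Or.inr (Or.inr ⟨hxM, hyM, Conn.of_openAdj ⟨e, hSe, hend⟩⟩), hx, hy⟩⟩
  · intro h
    induction h with
    | refl => exact Conn.refl G _ _
    | @tail x y _ hxy ih =>
      obtain ⟨hadj, hx, hy⟩ := hxy
      refine ih.trans ?_
      rcases hadj with ⟨hxM, _, e, hSe, hj⟩ | ⟨hiff, e, hj⟩ | ⟨hxM, _, hconn⟩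
      · -- a closed edge inside `M`: flipped open
        have hflip : e ∈ G.edgesAt (G.cluster S c) ∧ e ∉ G.edgesAt X := by
          refine ⟨G.mem_edgesAt_of_joins_left hj hxM, fun heX => ?_⟩
          rcases G.mem_or_mem_of_mem_edgesAt_of_joins hj heX with h | h
          · exact hx h
          · exact hy h
        have : G.flipM S c X e = true := by simp [flipM, hflip, hSe]
        exact Conn.of_openAdj ⟨e, this, hj⟩
      · -- an edge between `M` and `V ∖ M`: closed in `S`, flipped open
        have hj' : G.Joins e y x := by
          rcases hj with ⟨h1, h2⟩ | ⟨h1, h2⟩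
          · exact Or.inr ⟨h1, h2⟩
          · exact Or.inl ⟨h1, h2⟩
        have hSe : S e = false := by
          by_cases hxM : x ∈ G.cluster S c
          · exact G.eq_false_of_joins_of_mem_of_notMem hj hxM (hiff.mp hxM)
          · have hyM : y ∈ G.cluster S c := by
              by_contra hyM
              exact hxM (hiff.mpr hyM)
            exact G.eq_false_of_joins_of_mem_of_notMem hj' hyM hxM
        have hflip : e ∈ G.edgesAt (G.cluster S c) ∧ e ∉ G.edgesAt X := by
          refine ⟨?_, fun heX => ?_⟩
          · by_cases hxM : x ∈ G.cluster S c
            · exact G.mem_edgesAt_of_joins_left hj hxM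
            · have hyM : y ∈ G.cluster S c := by
                by_contra hyM
                exact hxM (hiff.mpr hyM)
              exact G.mem_edgesAt_of_joins_right hj hyM
          · rcases G.mem_or_mem_of_mem_edgesAt_of_joins hj heX with h | h
            · exact hx h
            · exact hy h
        have : G.flipM S c X e = true := by simp [flipM, hflip, hSe]
        exact Conn.of_openAdj ⟨e, this, hj⟩
      · -- movement inside an `S`-cluster away from `M`: nothing is flipped there
        refine conn_of_open_edges (fun e he hK => ?_) hconn
        have hnot : e ∉ G.edgesAt (G.cluster S c) := by
          intro hM
          rcases hK with hK | hK <;> rcases hM with hM | hM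
          · exact G.not_mem_cluster_c_of_mem_cluster hxM hK hM
          · exact G.not_mem_cluster_c_of_mem_cluster hxM (G.snd_mem_cluster_of_open he hK) hM
          · exact G.not_mem_cluster_c_of_mem_cluster hxM (G.fst_mem_cluster_of_open he hK) hM
          · exact G.not_mem_cluster_c_of_mem_cluster hxM hK hM
        have : G.flipM S c X e = S e := by simp [flipM, hnot]
        rw [this]
        exact he

/-- **Theorem B (a)**: `u ~ v` in `δ(S) = S Δ E[Com_c S]` iff `u ~_H v`. -/
theorem conn_kSwap_iff_hConn (S : Config E) (c u v : V) :
    G.Conn (G.kSwap c S) u v ↔ G.HConn S c u v := by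
  rw [G.kSwap_eq_flipM, G.conn_flipM_iff (X := ∅) (fun _ _ => Iff.rfl) (Set.notMem_empty u)]
  unfold HConnAvoid HConn
  constructor
  · intro h
    induction h with
    | refl => exact Relation.ReflTransGen.refl
    | tail _ hxy ih => exact ih.tail hxy.1
  · intro h
    induction h with
    | refl => exact Relation.ReflTransGen.refl
    | tail _ hxy ih => exact ih.tail ⟨hxy, Set.notMem_empty _, Set.notMem_empty _⟩

/-- **Theorem B (b), (c)**: `u ∉ L = Com_b(S)` and `v` are connected in `τ(S) = S Δ (E[M] ∖ E[L])`
iff some H-walk avoiding `L` joins them. -/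
theorem conn_kSwapSealed_iff_hConnAvoid (S : Config E) (b c : V) {u : V}
    (hu : u ∉ G.cluster S b) (v : V) :
    G.Conn (G.kSwapSealed c b S) u v ↔ G.HConnAvoid S c (G.cluster S b) u v := by
  rw [G.kSwapSealed_eq_flipM]
  refine G.conn_flipM_iff ?_ hu v
  intro e he
  constructor
  · intro h
    exact G.snd_mem_cluster_of_open he h
  · intro h
    exact G.fst_mem_cluster_of_open he h

/-- **`τ₅₀(S) ∈ ac|b ⟺ c ~_H K in H − L`** for `S ∈ bot` (Theorem B (b)). -/
theorem cellAC_kSwapSealed_iff {S : Config E} {a b c : V} (h : G.IsBot S a b c) :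
    G.CellAC (G.kSwapSealed c b S) a b c ↔ G.HConnAvoid S c (G.cluster S b) c a := by
  obtain ⟨hab, hac, hbc⟩ := h
  have hL : G.cluster (G.kSwapSealed c b S) b = G.cluster S b := G.cluster_kSwapSealed_c c b S
  have hnot : ¬ G.Conn (G.kSwapSealed c b S) a b := by
    intro hab'
    have : a ∈ G.cluster (G.kSwapSealed c b S) b := hab'.symm
    rw [hL] at this
    exact hab (this : G.Conn S b a).symm
  constructor
  · intro hcell
    exact (G.conn_kSwapSealed_iff_hConnAvoid S b c (fun hc => hbc (hc : G.Conn S b c)) a).mp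
      hcell.1.symm
  · intro hwalk
    exact ⟨((G.conn_kSwapSealed_iff_hConnAvoid S b c (fun hc => hbc (hc : G.Conn S b c)) a).mpr
      hwalk).symm, hnot⟩

/-- **`τ₁₈(S) ∈ bc|a ⟺ c ~_H L in H − K`** for `S ∈ bot` (Theorem B (c)). -/
theorem cellBC_kSwapSealed_iff {S : Config E} {a b c : V} (h : G.IsBot S a b c) :
    G.CellBC (G.kSwapSealed c a S) a b c ↔ G.HConnAvoid S c (G.cluster S a) c b := by
  obtain ⟨hab, hac, hbc⟩ := h
  have hK : G.cluster (G.kSwapSealed c a S) a = G.cluster S a := G.cluster_kSwapSealed_c c a S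
  have hnot : ¬ G.Conn (G.kSwapSealed c a S) a b := by
    intro hab'
    have : b ∈ G.cluster (G.kSwapSealed c a S) a := hab'
    rw [hK] at this
    exact hab this
  constructor
  · intro hcell
    exact (G.conn_kSwapSealed_iff_hConnAvoid S a c (fun hc => hac (hc : G.Conn S a c)) b).mp
      hcell.1.symm
  · intro hwalk
    exact ⟨((G.conn_kSwapSealed_iff_hConnAvoid S a c (fun hc => hac (hc : G.Conn S a c)) b).mpr
      hwalk).symm, hnot⟩

variable [Fintype E] [DecidableEq E]

open Classical in
/-- **The D-free inequality in mine-3's H-graph form** is `DFreeIneq`: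
`#{bot : a ~_H b} ≤ #{bot : c ~_H a avoiding L} + #{bot : c ~_H b avoiding K}`. -/
theorem dFreeIneq_iff_hGraph (a b c : V) :
    G.DFreeIneq a b c ↔
      (Finset.univ.filter fun ω : Config E => G.IsBot ω a b c ∧ G.HConn ω c a b).card ≤
        (Finset.univ.filter fun ω : Config E =>
          G.IsBot ω a b c ∧ G.HConnAvoid ω c (G.cluster ω b) c a).card +
          (Finset.univ.filter fun ω : Config E =>
            G.IsBot ω a b c ∧ G.HConnAvoid ω c (G.cluster ω a) c b).card := by
  unfold DFreeIneq
  have e1 : (Finset.univ.filter fun ω : Config E => G.BotM ω a b c) =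
      Finset.univ.filter fun ω : Config E => G.IsBot ω a b c ∧ G.HConn ω c a b := by
    ext ω
    simp only [Finset.mem_filter, Finset.mem_univ, true_and, BotM, G.conn_kSwap_iff_hConn]
  have e2 : (Finset.univ.filter fun ω : Config E =>
      G.IsBot ω a b c ∧ G.CellAC (G.kSwapSealed c b ω) a b c) =
      Finset.univ.filter fun ω : Config E =>
        G.IsBot ω a b c ∧ G.HConnAvoid ω c (G.cluster ω b) c a := by
    ext ω
    simp only [Finset.mem_filter, Finset.mem_univ, true_and]
    constructor
    · rintro ⟨h1, h2⟩
      exact ⟨h1, (G.cellAC_kSwapSealed_iff h1).mp h2⟩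
    · rintro ⟨h1, h2⟩
      exact ⟨h1, (G.cellAC_kSwapSealed_iff h1).mpr h2⟩
  have e3 : (Finset.univ.filter fun ω : Config E =>
      G.IsBot ω a b c ∧ G.CellBC (G.kSwapSealed c a ω) a b c) =
      Finset.univ.filter fun ω : Config E =>
        G.IsBot ω a b c ∧ G.HConnAvoid ω c (G.cluster ω a) c b := by
    ext ω
    simp only [Finset.mem_filter, Finset.mem_univ, true_and]
    constructor
    · rintro ⟨h1, h2⟩
      exact ⟨h1, (G.cellBC_kSwapSealed_iff h1).mp h2⟩
    · rintro ⟨h1, h2⟩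
      exact ⟨h1, (G.cellBC_kSwapSealed_iff h1).mpr h2⟩
  rw [e1, e2, e3]

end HGraph

end MultiGraph

end PercRepro
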